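/-
Width seat `ym-line-cbag-p1-w3` (prover-ym-line-cbag-p1-w3-g8-0), the only seat left on LINE 3 `route-QuantumFields-SixPlaneColdBox`:
REGISTERED STUB 2 `stub_slackAbsorptionG : SlackAbsorptionG` of the birth skeleton of crux `DensityTransferG` (stmt-QuantumFields-25709),
BY NAME, from w2's landed content `bulkDominatesBoxDensityG_of_slack` (prover-ym-line-cbag-p1-w2-g12-0, p607385 — the mathematics is theirs).
-/
import Summits.QuantumFields.YangMills.Theorems.SixPlaneColdBoxDensityTransferGDefs
import Summits.QuantumFields.YangMills.Theorems.SixPlaneColdBoxSlackAbsorption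

/-!
# Crux `DensityTransferG` (stmt-QuantumFields-25709), stub 2: `stub_slackAbsorptionG`

`SlackAbsorptionG` (the skeleton's stub 2, `Theorems/SixPlaneColdBoxDensityTransferGDefs.lean`) is literally
`(transfer with slack, spelled out) → BulkDominatesBoxDensityG`, and w2's `bulkDominatesBoxDensityG_of_slack`
(`Theorems/SixPlaneColdBoxSlackAbsorption.lean`: the landed positive cold-box floor `boxActionDensityFloor_allGroups` absorbs the additive
slack `β^{−(8A+m)}` into `η/2`, `slack_arith`) has exactly that hypothesis and conclusion.

No sorry; standard axioms.  NOT the Yang–Mills mass gap (RECORD-type node `LatticeNonFreezing`).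
-/

set_option autoImplicit false

namespace Summit.QuantumFields.YangMills.Theorems.SixPlaneColdBox

/-- **Registered stub 2 of crux `DensityTransferG`: slack absorption** (content: w2's `bulkDominatesBoxDensityG_of_slack`). -/
theorem stub_slackAbsorptionG : SlackAbsorptionG :=
  fun h => bulkDominatesBoxDensityG_of_slack h

end Summit.QuantumFields.YangMills.Theorems.SixPlaneColdBox
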